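import Mathlib
import HarnessLib
import Summits.NavierStokesRegularity.NavierStokesRegularity.Theorems.PoloidalWindowDoorPoloidalWindowRigiditySeparatedShearTest

/-!
# Route `PoloidalWindowDoor`, crux `PoloidalWindowRigidity` (K2, stmt-NavierStokesRegularity-19708) —
# THE SEPARATED-PRESSURE STRATUM WITH NON-NEGATIVE CLEBSCH PRODUCTION IS EMPTY: `∇_h f₂ ≡ 0`, `Λ ≥ 0` ⇒ `v ≡ 0`

Cell ns-regularity-ideate, seat ns-poloidal-K2-p2 (stub-worker, gen 2; support theorems `--supports` the crux,
`--as helper`).  Generalisation of `…ConstantShear` (constant proportional shear `∂₂v_h ≡ μ∇_h v₂`, `μ < 1`): the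
same (M)-consuming dynamic argument («the horizontal variance of `v₂` has no past») runs on the whole stratum of the
residue S2⁗ on which

* the vertical component `f₂` of the residual `f = ∂ₜv + (v·∇)v − Δv` has no horizontal gradient (`hsep`; for an
  ancient mild solution `f = −∇p`, so this says `∂₂p(t,·)` depends on the height only — K2-p3's separated pressure), and
* the Clebsch production `∇_h v₂ · (∇_h v₂ − ∂₂v_h)` is pointwise non-negative (`hprod`; on the proportional-shear
  stratum it equals `(1 − μ)|∇_h v₂|²`, whence `μ < 1` there; in Clebsch variables `v_h = ∇_h φ`, `∂₂φ = v₂ + Λ`-terms it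
  is the sign of the slope defect).

Under these two hypotheses the horizontal variance of `v₂` obeys the 1-D conservation law of `…SeparatedShearVariance`
with non-positive source, its weighted mass vanishes at large scales (`…SeparatedShearDecay.variance_small_sep`), the
tested vertical momentum equation (`…SeparatedShearTest`) then makes `f₂(t,·)` constant in the height, hence spatially
constant, and K2-p3's `…VerticalSourceGauge.eq_zero_of_verticalSourceGauge` ends.

* `integral_vres_mul_bumps_eq_zero_sep` — `∫ f₂(t,z)(ρ₁ − ρ₂)(z) dz = 0` for two normalised bumps of equal radius;
* `vres_eq_sep` — `f₂(t,·)` is constant in the height;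
* `eq_zero_of_separatedShear` — **class + poloidal + `∇_h f₂ ≡ 0` + production `≥ 0` ⇒ `v ≡ 0`**;
* `nonflatLiouville_of_separatedShear` — the same in the stub's currency `¬ IsBackwardSingularPoint v 0`.

WHAT THIS IS NOT: not a claim about Navier–Stokes regularity and not the open residue S2⁗ — one more settled stratum
(bears_on LADDER-NS N0, rung N0-LocalTubeDoorPoloidal), strictly containing the constant-shear stratum `μ < 1`.
-/


noncomputable section

-- the summit and its single sub-problem share the name (CONVENTIONS §1), as in every Theorems file
set_option linter.dupNamespace false

namespace Summit.NavierStokesRegularity.NavierStokesRegularity.Theorems.PoloidalWindowDoorPoloidalWindowRigiditySeparatedShear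

open MeasureTheory Set Function Filter Topology Metric InnerProductSpace
open scoped RealInnerProductSpace InnerProductSpace Laplacian ContDiff
open Literature.Analysis Literature.Analysis.FluidPDE
open Summit.NavierStokesRegularity.NavierStokesRegularity.Theorems.PoloidalWindowDoorPoloidalWindowRigidityWindow
open Summit.NavierStokesRegularity.NavierStokesRegularity.Theorems.PoloidalWindowDoorPoloidalWindowRigidityClassRate
open Summit.NavierStokesRegularity.NavierStokesRegularity.Theorems.PoloidalWindowDoorPoloidalWindowRigidityHorizontalMean
open Summit.NavierStokesRegularity.NavierStokesRegularity.Theorems.PoloidalWindowDoorPoloidalWindowRigidityConstantShearMeans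
open Summit.NavierStokesRegularity.NavierStokesRegularity.Theorems.PoloidalWindowDoorPoloidalWindowRigidityConstantShearSlice
open Summit.NavierStokesRegularity.NavierStokesRegularity.Theorems.PoloidalWindowDoorPoloidalWindowRigidityConstantShearVariance
open Summit.NavierStokesRegularity.NavierStokesRegularity.Theorems.PoloidalWindowDoorPoloidalWindowRigidityConstantShearTest
open Summit.NavierStokesRegularity.NavierStokesRegularity.Theorems.PoloidalWindowDoorPoloidalWindowRigiditySeparatedShearVariance
open Summit.NavierStokesRegularity.NavierStokesRegularity.Theorems.PoloidalWindowDoorPoloidalWindowRigiditySeparatedShearDecay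
open Summit.NavierStokesRegularity.NavierStokesRegularity.Theorems.PoloidalWindowDoorPoloidalWindowRigiditySeparatedShearTest
open Summit.NavierStokesRegularity.NavierStokesRegularity.Theorems.PoloidalWindowDoorPoloidalWindowRigidityVerticalSourceGauge
open Summit.NavierStokesRegularity.NavierStokesRegularity.Theorems.PoloidalWindowDoorPoloidalWindowRigidityFlat

variable {C : ℝ} {v : ℝ → EuclideanSpace ℝ (Fin 3) → EuclideanSpace ℝ (Fin 3)}

section Class

variable (hrate : HasTypeITimeDecay C v) (hcont : ContinuousOn (uncurry v) (Iio (0 : ℝ) ×ˢ univ))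
  (hmild : ∀ s t : ℝ, s < t → t < 0 → ∀ x,
    v t x = UnboundedOperators.heatExtension (v s) (t - s) x - oseenDuhamel 1 s v v t x)
  (hdiv : ∀ t < 0, VectorCalculus.IsDivFree (v t))
  (hpol : ∀ s < 0, ∀ y, ⟪curl (v s) y, EuclideanSpace.single 2 1⟫_ℝ = 0)

include hrate hcont hmild hdiv hpol

omit hpol in
/-- **`∫ f₂(t,z) (ρ₁ − ρ₂)(z) dz = 0`** for two normalised bumps (separated-pressure version of
`…ConstantShear.integral_vres_mul_bumps_eq_zero`: tested momentum equation + `variance_small_sep`). -/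
theorem integral_vres_mul_bumps_eq_zero_sep
    (hsep : ∀ t < 0, ∀ x, ∀ b : Fin 3, b ≠ 2 →
      fderiv ℝ (fun y => timeDerivWithin (Iio 0) v t y + convect (v t) (v t) y - Δ (v t) y) x
        (EuclideanSpace.single b 1) 2 = 0)
    (hprod : ∀ t < 0, ∀ x,
      0 ≤ fderiv ℝ (fun y => v t y 2) x (EuclideanSpace.single 0 (1 : ℝ)) *
            (fderiv ℝ (fun y => v t y 2) x (EuclideanSpace.single 0 (1 : ℝ)) - fderiv ℝ (v t) x (EuclideanSpace.single 2 (1 : ℝ)) 0) +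
          fderiv ℝ (fun y => v t y 2) x (EuclideanSpace.single 1 (1 : ℝ)) *
            (fderiv ℝ (fun y => v t y 2) x (EuclideanSpace.single 1 (1 : ℝ)) - fderiv ℝ (v t) x (EuclideanSpace.single 2 (1 : ℝ)) 1))
    {t : ℝ} (ht : t < 0) {z₁ z₂ : ℝ} (β₁ : ContDiffBump z₁) (β₂ : ContDiffBump z₂) :
    ∫ z, vres v t z * (β₁.normed volume z - β₂.normed volume z) = 0 := by
  -- a fixed bump in the plane, the class rates
  set φ : ContDiffBump (0 : EuclideanSpace ℝ (Fin 2)) := ⟨1, 2, one_pos, one_lt_two⟩ with hφ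
  obtain ⟨C₁, hC₁⟩ := exists_fderiv_rate_of_class hrate hcont hmild
  obtain ⟨C₄, hC₄⟩ := exists_timeDeriv_rate_of_class hrate hcont hmild
  -- the test function `ρ = ρ₁ − ρ₂` and the window `[a, b]`
  set ρ : ℝ → ℝ := fun z => β₁.normed volume z - β₂.normed volume z with hρdef
  set a : ℝ := min (z₁ - β₁.rOut) (z₂ - β₂.rOut) with ha
  set b : ℝ := max (z₁ + β₁.rOut) (z₂ + β₂.rOut) with hb
  have hab : a ≤ b := by
    have h1 : a ≤ z₁ - β₁.rOut := min_le_left _ _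
    have h2 : z₁ + β₁.rOut ≤ b := le_max_left _ _
    linarith [β₁.rOut_pos]
  have hρ : ContDiff ℝ 1 ρ := (β₁.contDiff_normed (n := 1)).sub (β₂.contDiff_normed (n := 1))
  have hout : ∀ z ∉ Icc a b, z ∉ Metric.ball z₁ β₁.rOut ∧ z ∉ Metric.ball z₂ β₂.rOut := by
    intro z hz
    rw [mem_Icc, not_and_or, not_le, not_le] at hz
    have h1 : a ≤ z₁ - β₁.rOut := min_le_left _ _
    have h2 : a ≤ z₂ - β₂.rOut := min_le_right _ _
    have h3 : z₁ + β₁.rOut ≤ b := le_max_left _ _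
    have h4 : z₂ + β₂.rOut ≤ b := le_max_right _ _
    constructor <;> rw [Metric.mem_ball, Real.dist_eq, abs_lt, not_and_or, not_lt, not_lt] <;>
      rcases hz with hz | hz
    · left; linarith
    · right; linarith
    · left; linarith
    · right; linarith
  have hρ0 : ∀ z ∉ Icc a b, ρ z = 0 := by
    intro z hz
    obtain ⟨h1, h2⟩ := hout z hz
    have e1 : β₁.normed volume z = 0 := by
      rw [← Function.notMem_support, β₁.support_normed_eq]; exact h1
    have e2 : β₂.normed volume z = 0 := by
      rw [← Function.notMem_support, β₂.support_normed_eq]; exact h2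
    simp [hρdef, e1, e2]
  have hρ1 : ∀ z ∉ Icc a b, deriv ρ z = 0 := by
    intro z hz
    have hopen : IsOpen (Icc a b)ᶜ := isClosed_Icc.isOpen_compl
    have hev : ρ =ᶠ[𝓝 z] fun _ => (0 : ℝ) := by
      filter_upwards [hopen.mem_nhds hz] with w hw using hρ0 w hw
    rw [hev.deriv_eq, deriv_const]
  have hρi : ∫ z, ρ z = 0 := by
    simp only [hρdef]
    rw [integral_sub β₁.integrable_normed β₂.integrable_normed, β₁.integral_normed, β₂.integral_normed, sub_self]
  -- bounds for `ρ'` and `‖ρ‖₁`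
  have hρ'c : Continuous (deriv ρ) := hρ.continuous_deriv le_rfl
  have hρ'supp : HasCompactSupport (deriv ρ) :=
    HasCompactSupport.of_support_subset_isCompact isCompact_Icc fun z hz => by
      by_contra h; exact hz (hρ1 z h)
  obtain ⟨B₁, hB₁⟩ := hρ'supp.exists_bound_of_continuous hρ'c
  have hB₁' : ∀ z, |deriv ρ z| ≤ B₁ := fun z => by rw [← Real.norm_eq_abs]; exact hB₁ z
  have hB₁0 : 0 ≤ B₁ := (norm_nonneg _).trans (hB₁ 0)
  set N : ℝ := ∫ z, |ρ z| with hN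
  have hN0 : 0 ≤ N := integral_nonneg fun z => abs_nonneg _
  set Kc : ℝ := ((C / Real.sqrt (-t) * (C / Real.sqrt (-t)) + C₁ / (-t)) + C₁ / (-t) +
    2 * (C / Real.sqrt (-t) * (C / Real.sqrt (-t))) + C₄ / ((-t) * Real.sqrt (-t)) * (b - a)) * bumpK φ with hKc
  -- the estimate at every scale `R > 0`
  have hest : ∀ R : ℝ, 0 < R → |∫ z, vres v t z * ρ z| ≤
      B₁ * (∫ z in Icc a b, sliceV φ R v t z) + N * (R⁻¹ * Kc) := by
    intro R hR
    have h := abs_integral_vres_mul_le_sep (φ := φ) hrate hcont hmild hdiv hsep hC₁ hC₄ hR ht hab hρ hρ0 hρ1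
      hρi hB₁'
    simpa only [hKc, hN, mul_assoc] using h
  -- `|∫ vres ρ| ≤ ε` for every `ε > 0`
  have hsmall : ∀ ε : ℝ, 0 < ε → |∫ z, vres v t z * ρ z| ≤ ε := by
    intro ε hε
    obtain ⟨R₀, hR₀, hvar⟩ := variance_small_sep (φ := φ) hrate hcont hmild hdiv hsep hprod hC₁ hC₄ ht a b
      (ε := ε / (2 * (B₁ + 1))) (by positivity)
    set R : ℝ := max R₀ (2 * N * |Kc| / ε + 1) with hRdef
    have hR₀R : R₀ ≤ R := le_max_left _ _
    have hR : 0 < R := lt_of_lt_of_le hR₀ hR₀R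
    have hR2 : 2 * N * |Kc| / ε + 1 ≤ R := le_max_right _ _
    have h1 := hest R hR
    have hV : ∫ z in Icc a b, sliceV φ R v t z ≤ ε / (2 * (B₁ + 1)) := hvar R hR₀R
    -- first term `≤ ε/2`
    have hT1 : B₁ * (∫ z in Icc a b, sliceV φ R v t z) ≤ ε / 2 := by
      calc B₁ * (∫ z in Icc a b, sliceV φ R v t z) ≤ B₁ * (ε / (2 * (B₁ + 1))) :=
            mul_le_mul_of_nonneg_left hV hB₁0
        _ = ε / 2 * (B₁ / (B₁ + 1)) := by field_simp
        _ ≤ ε / 2 * 1 := mul_le_mul_of_nonneg_left ((div_le_one (by linarith)).2 (by linarith)) (by positivity)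
        _ = ε / 2 := mul_one _
    -- second term `≤ ε/2`
    have hT2 : N * (R⁻¹ * Kc) ≤ ε / 2 := by
      have hle : N * (R⁻¹ * Kc) ≤ N * |Kc| / R := by
        rw [mul_comm R⁻¹, ← mul_assoc, ← div_eq_mul_inv]
        exact div_le_div_of_nonneg_right (mul_le_mul_of_nonneg_left (le_abs_self _) hN0) hR.le
      refine hle.trans ?_
      rw [div_le_iff₀ hR]
      have h3 : 2 * N * |Kc| / ε ≤ R := by linarith
      have h4 := mul_le_mul_of_nonneg_left h3 (by positivity : (0:ℝ) ≤ ε / 2)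
      have e : ε / 2 * (2 * N * |Kc| / ε) = N * |Kc| := by field_simp
      linarith [e]
    linarith
  -- hence `= 0`
  have h0 : |∫ z, vres v t z * ρ z| ≤ 0 := by
    by_contra hne
    push Not at hne
    have h := hsmall (|∫ z, vres v t z * ρ z| / 2) (by positivity)
    linarith
  exact abs_eq_zero.1 (le_antisymm h0 (abs_nonneg _))

omit hpol in
/-- **The vertical residual is height-independent** on the separated-pressure stratum with `Λ ≥ 0`. -/
theorem vres_eq_sep
    (hsep : ∀ t < 0, ∀ x, ∀ b : Fin 3, b ≠ 2 →
      fderiv ℝ (fun y => timeDerivWithin (Iio 0) v t y + convect (v t) (v t) y - Δ (v t) y) x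
        (EuclideanSpace.single b 1) 2 = 0)
    (hprod : ∀ t < 0, ∀ x,
      0 ≤ fderiv ℝ (fun y => v t y 2) x (EuclideanSpace.single 0 (1 : ℝ)) *
            (fderiv ℝ (fun y => v t y 2) x (EuclideanSpace.single 0 (1 : ℝ)) - fderiv ℝ (v t) x (EuclideanSpace.single 2 (1 : ℝ)) 0) +
          fderiv ℝ (fun y => v t y 2) x (EuclideanSpace.single 1 (1 : ℝ)) *
            (fderiv ℝ (fun y => v t y 2) x (EuclideanSpace.single 1 (1 : ℝ)) - fderiv ℝ (v t) x (EuclideanSpace.single 2 (1 : ℝ)) 1))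
    {t : ℝ} (ht : t < 0) (z₁ z₂ : ℝ) : vres v t z₁ = vres v t z₂ := by
  have hg : Continuous fun z => vres v t z := continuous_vres hrate hcont hmild hdiv ht
  -- two-sided bound `|g z₁ − g z₂| ≤ 2η` for every `η > 0`
  have key : ∀ η : ℝ, 0 < η → |vres v t z₁ - vres v t z₂| ≤ 2 * η := by
    intro η hη
    -- a common radius on which `g` oscillates by at most `η` about both points
    have hc1 := Metric.continuous_iff.1 hg z₁ η hη
    have hc2 := Metric.continuous_iff.1 hg z₂ η hη
    obtain ⟨r₁, hr₁, h₁⟩ := hc1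
    obtain ⟨r₂, hr₂, h₂⟩ := hc2
    set r : ℝ := min r₁ r₂ with hr
    have hr0 : 0 < r := lt_min hr₁ hr₂
    set β₁ : ContDiffBump z₁ := ⟨r / 2, r, by positivity, by linarith⟩ with hβ₁
    set β₂ : ContDiffBump z₂ := ⟨r / 2, r, by positivity, by linarith⟩ with hβ₂
    have hint := integral_vres_mul_bumps_eq_zero_sep hrate hcont hmild hdiv hsep hprod ht β₁ β₂
    -- `∫ g ρᵢ` is within `η` of `g zᵢ`
    have happrox : ∀ {c : ℝ} (β : ContDiffBump c), β.rOut ≤ r₁ ⊓ r₂ →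
        (∀ z, dist z c < β.rOut → dist (vres v t z) (vres v t c) < η) →
        |(∫ z, vres v t z * β.normed volume z) - vres v t c| ≤ η := by
      intro c β _ hosc
      have hi : Integrable fun z => vres v t z * β.normed volume z :=
        (hg.mul β.continuous_normed).integrable_of_hasCompactSupport β.hasCompactSupport_normed.mul_left
      have hic : Integrable fun z => vres v t c * β.normed volume z :=
        (continuous_const.mul β.continuous_normed).integrable_of_hasCompactSupport β.hasCompactSupport_normed.mul_left
      have hconst : ∫ z, vres v t c * β.normed volume z = vres v t c := by
        rw [integral_const_mul, β.integral_normed, mul_one]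
      have hsub : ∫ z, (vres v t z - vres v t c) * β.normed volume z =
          (∫ z, vres v t z * β.normed volume z) - vres v t c := by
        rw [show (fun z => (vres v t z - vres v t c) * β.normed volume z) =
          fun z => vres v t z * β.normed volume z - vres v t c * β.normed volume z from funext fun z => by ring,
          integral_sub hi hic, hconst]
      rw [← hsub]
      have hbd : ∀ z, |(vres v t z - vres v t c) * β.normed volume z| ≤ η * β.normed volume z := by
        intro z
        rw [abs_mul, abs_of_nonneg (β.nonneg_normed z)]
        by_cases hz : z ∈ Metric.ball c β.rOut
        · exact mul_le_mul_of_nonneg_right (le_of_lt (by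
            have := hosc z (Metric.mem_ball.1 hz); rwa [Real.dist_eq] at this)) (β.nonneg_normed z)
        · have : β.normed volume z = 0 := by rw [← Function.notMem_support, β.support_normed_eq]; exact hz
          simp [this]
      calc |∫ z, (vres v t z - vres v t c) * β.normed volume z|
          ≤ ∫ z, |(vres v t z - vres v t c) * β.normed volume z| := abs_integral_le_integral_abs
        _ ≤ ∫ z, η * β.normed volume z :=
            integral_mono_of_nonneg (Eventually.of_forall fun z => abs_nonneg _) (β.integrable_normed.const_mul η)
              (Eventually.of_forall hbd)
        _ = η := by rw [integral_const_mul, β.integral_normed, mul_one]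
    have hle : r ≤ r₁ ⊓ r₂ := le_rfl
    have ha1 := happrox β₁ hle fun z hz => h₁ z (lt_of_lt_of_le hz (min_le_left _ _))
    have ha2 := happrox β₂ hle fun z hz => h₂ z (lt_of_lt_of_le hz (min_le_right _ _))
    -- `∫ g (ρ₁ − ρ₂) = 0`
    have hsplit : ∫ z, vres v t z * (β₁.normed volume z - β₂.normed volume z) =
        (∫ z, vres v t z * β₁.normed volume z) - ∫ z, vres v t z * β₂.normed volume z := by
      simp only [mul_sub]
      exact integral_sub ((hg.mul β₁.continuous_normed).integrable_of_hasCompactSupport β₁.hasCompactSupport_normed.mul_left)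
        ((hg.mul β₂.continuous_normed).integrable_of_hasCompactSupport β₂.hasCompactSupport_normed.mul_left)
    rw [hsplit] at hint
    have e : vres v t z₁ - vres v t z₂ =
        -((∫ z, vres v t z * β₁.normed volume z) - vres v t z₁) +
          ((∫ z, vres v t z * β₂.normed volume z) - vres v t z₂) := by linarith
    rw [e]
    calc _ ≤ |-((∫ z, vres v t z * β₁.normed volume z) - vres v t z₁)| +
          |(∫ z, vres v t z * β₂.normed volume z) - vres v t z₂| := abs_add_le _ _
      _ ≤ η + η := by rw [abs_neg]; exact add_le_add ha1 ha2
      _ = 2 * η := by ring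
  have h0 : |vres v t z₁ - vres v t z₂| ≤ 0 := by
    by_contra hne
    push Not at hne
    have h := key (|vres v t z₁ - vres v t z₂| / 4) (by positivity)
    linarith
  exact sub_eq_zero.1 (abs_eq_zero.1 (le_antisymm h0 (abs_nonneg _)))

/-- **THE SEPARATED-PRESSURE STRATUM WITH NON-NEGATIVE CLEBSCH SLOPE IS EMPTY IN THE CLASS.**  A profile of the route's
Type-I class (rate `C`, continuous, unit-viscosity Oseen-mild, divergence-free), poloidal along `e₃`, whose vertical
residual has no horizontal gradient (`∇_h f₂ ≡ 0`, i.e. `∂₂p(t,·)` depends on `x₂` only) and whose Clebsch production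
`∇_h v₂·(∇_h v₂ − ∂₂v_h)` (`= Λ|∇_hψ|²`) is pointwise non-negative, vanishes identically. -/
theorem eq_zero_of_separatedShear
    (hsep : ∀ t < 0, ∀ x, ∀ b : Fin 3, b ≠ 2 →
      fderiv ℝ (fun y => timeDerivWithin (Iio 0) v t y + convect (v t) (v t) y - Δ (v t) y) x
        (EuclideanSpace.single b 1) 2 = 0)
    (hprod : ∀ t < 0, ∀ x,
      0 ≤ fderiv ℝ (fun y => v t y 2) x (EuclideanSpace.single 0 (1 : ℝ)) *
            (fderiv ℝ (fun y => v t y 2) x (EuclideanSpace.single 0 (1 : ℝ)) - fderiv ℝ (v t) x (EuclideanSpace.single 2 (1 : ℝ)) 0) +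
          fderiv ℝ (fun y => v t y 2) x (EuclideanSpace.single 1 (1 : ℝ)) *
            (fderiv ℝ (fun y => v t y 2) x (EuclideanSpace.single 1 (1 : ℝ)) - fderiv ℝ (v t) x (EuclideanSpace.single 2 (1 : ℝ)) 1)) :
    ∀ t < 0, ∀ x, v t x = 0 := by
  refine eq_zero_of_verticalSourceGauge hrate hcont hmild hdiv hpol fun t ht x => ?_
  have hx : (timeDerivWithin (Iio 0) v t x + convect (v t) (v t) x - Δ (v t) x) 2 =
      (timeDerivWithin (Iio 0) v t 0 + convect (v t) (v t) 0 - Δ (v t) 0) 2 := by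
    have h1 := residual_vert_eq_of_height_eq_of_sep hrate hcont hmild hdiv hsep ht
      (x := x) (x' := (x 2) • EuclideanSpace.single 2 (1 : ℝ)) (by simp)
    have h2 := residual_vert_eq_of_height_eq_of_sep hrate hcont hmild hdiv hsep ht
      (x := (0 : EuclideanSpace ℝ (Fin 3))) (x' := (0 : ℝ) • EuclideanSpace.single 2 (1 : ℝ)) (by simp)
    have h3 := vres_eq_sep hrate hcont hmild hdiv hsep hprod ht (x 2) 0
    simp only [vres] at h3
    rw [h1, h2, h3]
  simpa [EuclideanSpace.inner_single_right] using hx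

/-- **Separated pressure + `Λ ≥ 0` ⇒ not backward-singular** (the stub's currency). -/
theorem nonflatLiouville_of_separatedShear
    (hsep : ∀ t < 0, ∀ x, ∀ b : Fin 3, b ≠ 2 →
      fderiv ℝ (fun y => timeDerivWithin (Iio 0) v t y + convect (v t) (v t) y - Δ (v t) y) x
        (EuclideanSpace.single b 1) 2 = 0)
    (hprod : ∀ t < 0, ∀ x,
      0 ≤ fderiv ℝ (fun y => v t y 2) x (EuclideanSpace.single 0 (1 : ℝ)) *
            (fderiv ℝ (fun y => v t y 2) x (EuclideanSpace.single 0 (1 : ℝ)) - fderiv ℝ (v t) x (EuclideanSpace.single 2 (1 : ℝ)) 0) +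
          fderiv ℝ (fun y => v t y 2) x (EuclideanSpace.single 1 (1 : ℝ)) *
            (fderiv ℝ (fun y => v t y 2) x (EuclideanSpace.single 1 (1 : ℝ)) - fderiv ℝ (v t) x (EuclideanSpace.single 2 (1 : ℝ)) 1)) :
    ¬ IsBackwardSingularPoint v 0 :=
  not_backwardSingular_of_zero (eq_zero_of_separatedShear hrate hcont hmild hdiv hpol hsep hprod)

end Class

end Summit.NavierStokesRegularity.NavierStokesRegularity.Theorems.PoloidalWindowDoorPoloidalWindowRigiditySeparatedShear

end
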